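import Mathlib
import Summits.NavierStokesRegularity.NavierStokesRegularity.Theorems.TaoLadderRungThreeLocalDynamicsSufficesAt
import Summits.NavierStokesRegularity.NavierStokesRegularity.Theses.TrappingWindowRungThree
import Summits.NavierStokesRegularity.NavierStokesRegularity.Theses.ExactWindowRungThree
import HarnessLib

/-!
# `TrappingWindowRungThree.LocalDynamicsSufficesAt` = `ExactWindowRungThree.LocalDynamicsSufficesAt`
  (item stmt-NavierStokesRegularity-21752, wanted by both routes)

The support `LocalDynamicsSufficesAt` of routes `TrappingWindowRungThree` and
`ExactWindowRungThree` is, character for character, the shared support `LocalDynamicsSufficesAt`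
of routes `TaoLadderRungThree` / `TaoLadderRungTwo` / `TaoLadderRungTwoPoly`
(items stmt-NavierStokesRegularity-20426 / 20652), already proved in the tree via
`Theorems.LocalDynamicsSufficesAt.noGlobalCascade_of_local`
(file `TaoLadderRungThreeLocalDynamicsSufficesAt.lean`): for `ε₀ > 0` and `R ≥ 1`,
`DynamicsLocalAt ε₀ R` yields a table `α ∈ InTableClass R` and a datum `X₀` with
`NoGlobalCascade ε₀ α X₀` (ℤ-induction on the checkpoint level along the restriction of a global
pseudo-solution). This file closes the new item in BOTH route readings by that theorem.

HONEST FRAMING: bookkeeping about Tao-type MODEL lattice pseudo-flows (Tao 2016 §6.1–6.2); nothing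
here is a statement about the Navier–Stokes equations, and the routes' rung leaf
(`TaoLadderRungThree.Target`, TL-M3) is not the summit Statement.
-/

noncomputable section

set_option linter.dupNamespace false

namespace Summit.NavierStokesRegularity.NavierStokesRegularity.Theorems

open LocalDynamicsSufficesAt in
/-- **Item stmt-NavierStokesRegularity-21752** read in route `TrappingWindowRungThree`
(`TrappingWindowRungThree.LocalDynamicsSufficesAt`): for `ε₀ > 0` and `R ≥ 1`,
`DynamicsLocalAt ε₀ R` gives `α ∈ InTableClass R` and `X₀` with `NoGlobalCascade ε₀ α X₀`, closed
by the tree theorem `LocalDynamicsSufficesAt.noGlobalCascade_of_local`.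
[cite: Tao2016AveragedNS, §6.2 p. 32 with §6.1 p. 31] -/
theorem trappingWindowRungThree_localDynamicsSufficesAt_proof :
    Summit.NavierStokesRegularity.NavierStokesRegularity.Theses.TrappingWindowRungThree.LocalDynamicsSufficesAt := by
  unfold
    Summit.NavierStokesRegularity.NavierStokesRegularity.Theses.TrappingWindowRungThree.LocalDynamicsSufficesAt
  intro ε₀ R hε₀ _hR hdyn
  obtain ⟨θ, c, i₀, α, X₀, P, Q, _hθ0, hθ, hc, hα, hX₀, hP, hstep⟩ := hdyn
  exact ⟨α, X₀, hα, noGlobalCascade_of_local (Q := Q) hε₀ hθ hc hX₀ hP hstep⟩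

open LocalDynamicsSufficesAt in
/-- **Item stmt-NavierStokesRegularity-21752** read in route `ExactWindowRungThree`
(`ExactWindowRungThree.LocalDynamicsSufficesAt`): the same statement, closed by the same tree
theorem `LocalDynamicsSufficesAt.noGlobalCascade_of_local`.
[cite: Tao2016AveragedNS, §6.2 p. 32 with §6.1 p. 31] -/
theorem exactWindowRungThree_localDynamicsSufficesAt_proof :
    Summit.NavierStokesRegularity.NavierStokesRegularity.Theses.ExactWindowRungThree.LocalDynamicsSufficesAt := by
  unfold
    Summit.NavierStokesRegularity.NavierStokesRegularity.Theses.ExactWindowRungThree.LocalDynamicsSufficesAt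
  intro ε₀ R hε₀ _hR hdyn
  obtain ⟨θ, c, i₀, α, X₀, P, Q, _hθ0, hθ, hc, hα, hX₀, hP, hstep⟩ := hdyn
  exact ⟨α, X₀, hα, noGlobalCascade_of_local (Q := Q) hε₀ hθ hc hX₀ hP hstep⟩

end Summit.NavierStokesRegularity.NavierStokesRegularity.Theorems

end
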